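import Summits.QuantumFields.QCD.Theses.TransparentRPWall
import Literature.MathematicalPhysics.QuantumLattice.GrassmannIntegralProofs
import HarnessLib.Audit

/-!
# Sketch — crux-strategist r1 on `WallTransparency` (stmt-QuantumFields-17994)

(1) The typed REPAIR of the crux (off-wall supports) and the matching restate of `DiagonalRPClosure`;
(2) the glue step `WallDiagonalRP` from the repaired pieces (proof that the assembly survives the repair);
(3) the exact Clifford certificate behind the wall-contact divergence: the fermion hopping-expansion weight of an
    elementary plaquette in the `(0,1)`-plane is `tr[(1-γ₀)(1-γ₁)(1+γ₀)(1+γ₁)] = -8` for Wilson quarks but the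
    re-spun wall plaquette carries `(1-γₙ)(1+γₙ)(1+γₙ)(1-γₙ) = 0` (`γₙ² = 1`).
-/

namespace Summit.QuantumFields.QCD.Theses.TransparentRPWall.StrategistR1

open scoped BigOperators Topology Classical MeasureTheory Matrix ComplexConjugate
open Filter Set Function MeasureTheory
open Literature.MathematicalPhysics.QuantumLattice Literature.MathematicalPhysics.AQFT
  Literature.MathematicalPhysics.QuantumFieldTheory Literature.Probability.LatticeModels

/-- **WallTransparencyR** — the crux with its conclusion restricted to real test functions compactly supported OFF the wall
hyperplane `{x₀ = x₁}` (the only supports the assembly ever uses). -/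
def WallTransparencyR : Prop :=
  open Literature.MathematicalPhysics.QuantumLattice Literature.MathematicalPhysics.AQFT Literature.MathematicalPhysics.QuantumFieldTheory Literature.Probability.LatticeModels in let E := EuclideanSpace ℝ (Fin 4); let SU3 := ↥(Matrix.specialUnitaryGroup (Fin 3) ℂ); let γn : Matrix (Fin 4) (Fin 4) ℂ := (((Real.sqrt 2)⁻¹ : ℝ) : ℂ) • (euclideanGamma 0 - euclideanGamma 1); let Wfun : (Nf : ℕ) → QCDScheme Nf → ℕ → (n : ℕ) → (Fin n → QCDField Nf) → (Fin n → SchwartzMap E ℝ) → ℂ := fun Nf sch k n σ f => (let T := TiltedTorus.Site (sch.side k); let C := TiltedTorus.Config (sch.side k) SU3; let ρ := fundamentalRep (Fin 3); let V := Fin Nf × (T × Fin 3 × Fin 4); let I := Fin (Fintype.card V); let e : V ≃ I := Fintype.equivFin V; let A := GrassmannAlgebra ℂ (I ⊕ₗ I); let wall : T → Prop := fun x => x.1 = 0 ∨ x.1 = ((sch.side k : ℕ) : ZMod (2 * sch.side k)); let Γ : Fin 4 → T → T → Matrix (Fin 4) (Fin 4) ℂ := fun μ x y => if (μ = 0 ∨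 μ = 1) ∧ (wall x ∨ wall y) then (if μ = 0 then γn else -γn) else euclideanGamma μ; let D : C → Matrix I I ℂ := fun U => Matrix.reindex e e (Matrix.of fun v w => if v.1 = w.1 then ((if v.2 = w.2 then ((sch.mq v.1 k + 4 : ℝ) : ℂ) else 0) - (1 / 2 : ℂ) * ∑ μ : Fin 4, ((if w.2.1 = v.2.1 + TiltedTorus.step μ then (1 - Γ μ v.2.1 w.2.1) v.2.2.2 w.2.2.2 * ρ (U (v.2.1, μ)) v.2.2.1 w.2.2.1 else 0) + (if v.2.1 = w.2.1 + TiltedTorus.step μ then (1 + Γ μ v.2.1 w.2.1) v.2.2.2 w.2.2.2 * ρ ((U (w.2.1, μ))⁻¹) v.2.2.1 w.2.2.1 else 0))) else 0); let boltz : C → A := fun U => grassmannExp (quadratic ℂ (-D U)); let P : Fin Nf → Fin Nf → T → A := fun fl g x => ∑ a : Fin 3, ∑ α : Fin 4, ∑ β : Fin 4, (Complex.I * gammaFive α β) • (psiBar ℂ (e (fl, (x, a, α))) * psi ℂ (e (g, (x, a, β)))); let ins : C → QCDField Nf → Site 4 → A := fun U s x => let y := TiltedTorus.proj (sch.side k)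 x; match s with | .glue => algebraMap ℂ A ((actionDensity ρ (configShift (-x) (TiltedTorus.lift (sch.side k) U)) : ℝ) : ℂ) | .pseudoRe fl g => (1 / 2 : ℂ) • (P fl g y + P g fl y) | .pseudoIm fl g => (-Complex.I / 2) • (P fl g y - P g fl y); let sm : C → QCDField Nf → SchwartzMap E ℝ → A := fun U s h => ∑ x ∈ box 4 (sch.L k), ((sch.z s k * sch.a k ^ 4 * h (sch.a k • siteToE x) : ℝ) : ℂ) • (ins U s x - algebraMap ℂ A ((sch.shift s k : ℝ) : ℂ)); let wt : C → ℂ := fun U => ((TiltedTorus.weight ρ (sch.β k) U : ℝ) : ℂ); let ber := GrassmannAlgebra.berezin ℂ (I ⊕ₗ I); let ν := (TiltedTorus.haar (sch.side k) : Measure C); if n = 0 then (1 : ℂ) else (∫ U, ber ((List.ofFn fun i => sm U (σ i) (f i)).prod * boltz U) * wt U ∂ν) / (∫ U, ber (boltz U) * wt U ∂ν)); ∀ (Nf : ℕ) (sch : QCDScheme Nf) (S : LabelledSchwingerFamily (QCDField Nf) E), (S.IsNormalized ∧ S.IsHermitian ∧ S.HasLinearGrowth ∧ S.IsReflectionPositive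 ∧ S.IsSymmetric ∧ S.HasClusterProperty) → (sch.HasAsymptoticScaling ∧ (∀ fl : Fin Nf, ∀ᶠ k in Filter.atTop, -1 < sch.mq fl k) ∧ (∀ (n : ℕ), n ≠ 0 → ∀ (σ : Fin n → QCDField Nf) (f : Fin n → SchwartzMap E ℝ) (F : SchwartzMap (Fin n → E) ℂ), IsTensorOf F (fun i => ofRealTest (f i)) → IsOffDiagonal F → Filter.Tendsto (fun k : ℕ => qcdLatticeSchwinger sch k n σ f) Filter.atTop (nhds (S n σ F)))) → (∃ Δ : ℝ, 0 < Δ ∧ S.HasMassGap Δ ∧ sch.HasLatticeMassGap Δ) → ∃ Λ : (ℕ → (n : ℕ) → (Fin n → QCDField Nf) → (Fin n → SchwartzMap E ℝ) → ℂ), Λ = (fun k n σ f => Wfun Nf sch k n σ f) ∧ (∀ (k : ℕ) (σ : Fin 0 → QCDField Nf) (f : Fin 0 → SchwartzMap E ℝ), Λ k 0 σ f = 1) ∧ (∀ (n : ℕ), n ≠ 0 → ∀ (σ : Fin n → QCDField Nf) (f : Fin n → SchwartzMap E ℝ), (∀ i, HasCompactSupport (f i : E → ℝ)) → (∀ i j,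 i ≠ j → Disjoint (tsupport (f i : E → ℝ)) (tsupport (f j : E → ℝ))) → (∀ i, tsupport (f i : E → ℝ) ⊆ {y : E | y 0 ≠ y 1}) → ∀ F : SchwartzMap (Fin n → E) ℂ, IsTensorOf F (fun i => ofRealTest (f i)) → Filter.Tendsto (fun k : ℕ => Λ k n σ f) Filter.atTop (nhds (S n σ F)))

/-- **DiagonalRPClosureR** — the closure piece with hypothesis (1) (convergence of the approximants) asked only off the wall. -/
def DiagonalRPClosureR : Prop :=
  open Literature.MathematicalPhysics.QuantumLattice Literature.MathematicalPhysics.AQFT Literature.MathematicalPhysics.QuantumFieldTheory Literature.Probability.LatticeModels in let E := EuclideanSpace ℝ (Fin 4); let swapT : SchwartzMap E ℝ → SchwartzMap E ℝ := fun h => SchwartzMap.compCLMOfContinuousLinearEquiv ℝ (LinearIsometryEquiv.piLpCongrLeft 2 ℝ ℝ (Equiv.swap (0 : Fin 4) 1)).toContinuousLinearEquiv h; ∀ (ι : Type) (S : LabelledSchwingerFamily ι E) (Λ : (ℕ → (n : ℕ) → (Fin n → ι) → (Fin n → SchwartzMap E ℝ) → ℂ)), S.IsNormalized → (∀ (n :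 ℕ) (k : Fin n → ι) (R : E ≃ₗᵢ[ℝ] E), LinearMap.det (R.toLinearEquiv : E →ₗ[ℝ] E) = 1 → (∀ i : Fin 4, ∃ j : Fin 4, R (EuclideanSpace.single i 1) = EuclideanSpace.single j 1 ∨ R (EuclideanSpace.single i 1) = -EuclideanSpace.single j 1) → ∀ F : SchwartzMap (Fin n → E) ℂ, IsOffDiagonal F → S n k (linActMulti R F) = S n k F) → (∀ (k : ℕ) (σ : Fin 0 → ι) (f : Fin 0 → SchwartzMap E ℝ), Λ k 0 σ f = 1) → (∀ (n : ℕ), n ≠ 0 → ∀ (σ : Fin n → ι) (f : Fin n → SchwartzMap E ℝ), (∀ i, HasCompactSupport (f i : E → ℝ)) → (∀ i j, i ≠ j → Disjoint (tsupport (f i : E → ℝ)) (tsupport (f j : E → ℝ))) → (∀ i, tsupport (f i : E → ℝ) ⊆ {y : E | y 0 ≠ y 1}) → ∀ F : SchwartzMap (Fin n → E) ℂ, IsTensorOf F (fun i => ofRealTest (f i)) → Filter.Tendsto (fun k : ℕ => Λ k n σ f) Filter.atTop (nhds (S n σ F))) → (∀ (N : ℕ) (c : Fin N → ℂ) (deg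 : Fin N → ℕ) (lab : (j : Fin N) → Fin (deg j) → ι) (f : (j : Fin N) → Fin (deg j) → SchwartzMap E ℝ), (∀ j l, HasCompactSupport (f j l : E → ℝ) ∧ tsupport (f j l : E → ℝ) ⊆ {y : E | y 1 < y 0}) → ∀ᶠ k in Filter.atTop, let z := ∑ i, ∑ j, starRingEnd ℂ (c i) * c j * Λ k (deg i + deg j) (Fin.append (lab i ∘ Fin.rev) (lab j)) (Fin.append (fun l => swapT (f i (Fin.rev l))) (f j)); 0 ≤ z.re ∧ z.im = 0) → ∀ (R : E ≃ₗᵢ[ℝ] E) (a b : ℝ), a ^ 2 = 1 / 2 → b ^ 2 = 1 / 2 → R (EuclideanSpace.single 0 1) = a • EuclideanSpace.single 0 1 + b • EuclideanSpace.single 1 1 → LabelledSchwingerFamily.IsReflectionPositive (fun n (k : Fin n → ι) => (S n k).comp (linActMulti R))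

/-- The assembly step survives the repair verbatim: `CoverWallRP → WallTransparencyR → DiagonalRPClosureR → WallDiagonalRP`. -/
theorem WallDiagonalRP_of_repaired (hCover : CoverWallRP) (hTrans : WallTransparencyR) (hRPC : DiagonalRPClosureR) :
    WallDiagonalRP := by
  intro Nf sch S hW R a b ha hb hRe0
  obtain ⟨⟨hnorm, hherm, hgrowth, hrp, hsymm, hclus, -, hhyp⟩, ⟨hAF, hbr, hconv⟩, Δ, hΔ, hgap, hlat⟩ := hW
  obtain ⟨Λ₀, hΛ, h0, hcv⟩ :=
    hTrans Nf sch S ⟨hnorm, hherm, hgrowth, hrp, hsymm, hclus⟩ ⟨hAF, hbr, hconv⟩ ⟨Δ, hΔ, hgap, hlat⟩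
  exact hRPC _ S Λ₀ hnorm hhyp h0 hcv (hCover Nf sch hAF hbr ⟨Δ, hΔ, hlat⟩ Λ₀ hΛ) R a b ha hb hRe0

/-! ## The Clifford certificate of the wall-contact term -/

/-- The wall's Clifford element `γₙ = (γ₀ − γ₁)/√2` (VERBATIM the `γn` of the items). -/
noncomputable def gammaN : Matrix (Fin 4) (Fin 4) ℂ :=
  (((Real.sqrt 2)⁻¹ : ℝ) : ℂ) • (euclideanGamma 0 - euclideanGamma 1)

theorem gammaN_mul_self : gammaN * gammaN = 1 := by
  have h01 : euclideanGamma 0 * euclideanGamma 1 = -(euclideanGamma 1 * euclideanGamma 0) :=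
    euclideanGamma_mul_of_ne (by decide)
  have hA : (euclideanGamma 0 - euclideanGamma 1) * (euclideanGamma 0 - euclideanGamma 1) =
      (2 : ℂ) • (1 : Matrix (Fin 4) (Fin 4) ℂ) := by
    simp only [sub_mul, mul_sub, euclideanGamma_mul_self, h01, two_smul]
    abel
  have hc : ((((Real.sqrt 2)⁻¹ : ℝ) : ℂ) * (((Real.sqrt 2)⁻¹ : ℝ) : ℂ)) = (2 : ℂ)⁻¹ := by
    rw [← Complex.ofReal_mul, ← mul_inv, Real.mul_self_sqrt (by norm_num : (0:ℝ) ≤ 2)]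
    push_cast
    ring
  unfold gammaN
  rw [Matrix.smul_mul, Matrix.mul_smul, smul_smul, hA, smul_smul, hc, inv_mul_cancel₀ (two_ne_zero), one_smul]

/-- **Wall plaquette**: the hopping weight of the elementary `(0,1)` plaquette whose four links touch the wall layer is ZERO
(`(1-γₙ)(1+γₙ) = 1 - γₙ² = 0`). -/
theorem wall_plaquette_spin_factor :
    (1 - gammaN) * (1 + gammaN) * (1 + gammaN) * (1 - gammaN) = 0 := by
  have h : (1 - gammaN) * (1 + gammaN) = 0 := by
    have e : (1 - gammaN) * (1 + gammaN) = 1 - gammaN * gammaN := by noncomm_ring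
    rw [e, gammaN_mul_self, sub_self]
  rw [h, zero_mul, zero_mul]

/-- **Honest plaquette**: Wilson's `(0,1)` plaquette hopping weight has spin trace `-8`. -/
theorem honest_plaquette_spin_trace :
    Matrix.trace ((1 - euclideanGamma 0) * (1 - euclideanGamma 1) * (1 + euclideanGamma 0) * (1 + euclideanGamma 1)) = -8 := by
  rw [euclideanGamma_zero, euclideanGamma_one]
  simp [Matrix.trace, Matrix.mul_apply, Fin.sum_univ_four, Matrix.one_apply]
  ring_nf
  simp only [Complex.I_sq]
  ring

end Summit.QuantumFields.QCD.Theses.TransparentRPWall.StrategistR1
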